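import Literature.NumberTheory.LFunctions.StarkNoQuadraticSubfieldProofs
import HarnessLib

/-!
# STUB S · `stub_starkNoQuadSubfield`: Stark's no-quadratic-subfield zero-free interval with an
# inexplicit constant (line `subgroup-orthogonality-escape`, crux `DegreeOnePrimesEscape`)

Topic `Summits/QuantumAdvantage/QuantumAdvantage/Theorems`. The registered stub
`stub_starkNoQuadSubfield` of the line `subgroup-orthogonality-escape` (skeleton v4,
`Cruxes/DegreeOnePrimesEscape/Lines/subgroup-orthogonality-escape.lean`) is the docking statement
`StarkNoQuadSubfieldInexplicit` shared by all lines of the crux `stmt-QuantumAdvantage-11543`: for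
every degree `n` there is `c = c(n) > 0` such that for every number field `K` of degree `n` without
quadratic subfield, `ζ_K(σ) ≠ 0` on `[1 − c/log|d_K|, 1)`. It is the in-tree Literature theorem
`Stark1974_dedekindZeta_ne_zero_of_noQuadraticSubfield_holds` (Stark 1974 Thm. 3, discharged by the
first line lead in `StarkNoQuadraticSubfieldProofs.lean`) with `c = 1/(4·n!)`.

## References

* H. M. Stark, *Some effective cases of the Brauer–Siegel theorem*, Invent. Math. 23 (1974)
  135–152, Thm. 3. [Stark1974]
-/

noncomputable section

open scoped NumberField

namespace Summit.QuantumAdvantage.QuantumAdvantage.Theorems.DegreeOnePrimesEscape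

open Literature.NumberTheory.LFunctions Literature.NumberTheory.LFunctions.NumberField

/-- **STUB S of line `subgroup-orthogonality-escape`** (= `HeilbronnCount.StarkNoQuadSubfieldInexplicit`):
for every `n` there is `c > 0` (here `c = 1/(4·n!)`) such that for every number field `K` of degree
`n` without quadratic subfield and every `σ ∈ [1 − c/log|d_K|, 1)`, `ζ_K(σ) ≠ 0`. One cast away from
the Literature theorem `Stark1974_dedekindZeta_ne_zero_of_noQuadraticSubfield_holds`. -/
theorem stub_starkNoQuadSubfield : ∀ n : ℕ, ∃ c : ℝ, 0 < c ∧ ∀ (K : Type) [Field K] [NumberField K],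
    Module.finrank ℚ K = n → (∀ F : IntermediateField ℚ K, Module.finrank ℚ F ≠ 2) →
    ∀ σ : ℝ, 1 - c / Real.log ((NumberField.discr K).natAbs : ℝ) ≤ σ → σ < 1 →
      Literature.NumberTheory.LFunctions.dedekindZetaCont K σ ≠ 0 := by
  intro n
  refine ⟨1 / (4 * (n.factorial : ℝ)), by positivity, fun K _ _ hK hnq σ hσ hσ1 => ?_⟩
  refine Stark1974_dedekindZeta_ne_zero_of_noQuadraticSubfield_holds K hnq σ ?_ hσ1
  subst hK
  have : 1 / (4 * ((Module.finrank ℚ K).factorial : ℝ)) / Real.log ((NumberField.discr K).natAbs : ℝ)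
      = 1 / (4 * ((Module.finrank ℚ K).factorial : ℝ) * Real.log ((NumberField.discr K).natAbs : ℝ)) := by
    rw [div_div]
  linarith [this]

end Summit.QuantumAdvantage.QuantumAdvantage.Theorems.DegreeOnePrimesEscape

end
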